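import Summits.KontsevichZagierPeriods.KontsevichZagierPeriods.Theses.CoactionDevissage
import Summits.KontsevichZagierPeriods.KontsevichZagierPeriods.Theorems.FurushoPentagonSectorToKernelOfLeaves

/-!
# KontsevichZagierPeriods / CoactionDevissage — SPLIT of the deciding crux `RationalKernel` (stmt-KontsevichZagierPeriods-3165): `CubeResolution → AyoubEffectiveCubeKernel → RationalKernel`

Route `KontsevichZagierPeriods/CoactionDevissage`, deciding crux `RationalKernel` (rank 0; Conjecture 1
with `ℚ`-coefficients: every formal `ℤ`-combination `c` of integral representations with `KZ.eval c = 0`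
has a non-zero integer multiple in `KZ.relations`).  The crux is summit-strength BY NAME
(`kernelForm_iff_rationalKernel`, `kernelForm_iff_summit`), so the crux-strategist re-audit (RESTATED bin)
redirects it along Ayoub's compact presentation of effective periods — the SPLIT

  `CubeResolution → AyoubEffectiveCubeKernel → RationalKernel`,

whose two pieces are the hub-wide items stmt-KontsevichZagierPeriods-17978 and -18116 (both written out
below as hypotheses, so that no conjecture constant and no other route's declaration enters), and whose glue
is the route's support item `RationalKernelOfCubes` (stmt-KontsevichZagierPeriods-17690), closed BY NAME by
`rationalKernelOfCubes_proof` at the end of this file: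

* X₁ `CubeResolution` — GEOMETRY INSIDE THE RULES, transcendence-free (Hironaka strength): every integral
  representation is congruent modulo `KZ.relations` to a `ℤ`-combination of TAME CUBE classes `[[0,1]ⁿ, f]`,
  `f` real analytic on a neighbourhood of the closed cube (Ayoub 2014 Def. 9–10, Prop. 11 and
  Huber–Müller-Stach 2017 Thm. 12.2.1 at the level of VALUES; here at the level of MOVES).
* X₂ `AyoubEffectiveCubeKernel` — TRANSCENDENCE IN AYOUB'S LINEAR PRESENTATION (J. Ayoub, Ann. of Math. 181
  (2015) Conj. 1.1 at `k = ℚ` = Fresán 2024 Conj. 3.5): the kernel of `∫_{[0,1]^∞}` on `𝒪_{ℚ-alg}(𝔻̄^∞)` is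
  the `ℚ`-span of the type-(a) elements `∂G/∂zᵢ − G|_{zᵢ=1} + G|_{zᵢ=0}`.

THE SEAM (why this is not a cut along a trivial seam).  Neither piece mentions the other's vocabulary —
X₁ lives in the free abelian group on semialgebraic integral representations modulo the four move sets,
X₂ in a filtered algebra of algebraic power series with `n` commuting operators `∂ᵢ` and face maps, no
domains and no rule (2) — and joining them is the landed seven-step TRANSFER
`FurushoPentagon.SectorToKernel.kzKernel_of_cubeResolution_of_ayoubKernel`
(`Theorems/FurushoPentagonSectorToKernelOfLeaves.lean`), which this file invokes:
(1) resolve `c ∈ ker eval` into the tame cubical span (X₁); (2) MERGE the combination to one tame cube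
class (`ReducedPeriodRing.stub_cubeMerge`, `Theorems/FurushoPentagonReducedPeriodRingCubeMerge.lean`);
(3) make it Ayoub-ADMISSIBLE inside the moves (`stub_admissibleOfTame`,
`Theorems/FurushoPentagonSectorToKernelAdmissibleOfTame*.lean`); (4) `∫_{[0,1]ⁿ} = 0` by SOUNDNESS
(`KZ.relations_le_ker_eval_holds`); (5) REAL STOKES FORM of the padded integrand from X₂
(`stub_realStokesForm`, `Theorems/FurushoPentagonSectorToKernelRealStokesForm.lean` with
`…RsfAlgTransfer/RsfComplexify/RsfRealify.lean`); (6) `ℚ`-SEMIALGEBRAICITY of the analytic primitives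
(`stub_semialgebraicOfAlgebraic`); (7) PADDING + CALIBRATION of the Stokes span into `KZ.relations`
(`stub_stokesSpanCalibration`).  The output is the kernel form of Conjecture 1, whence `RationalKernel`
with the multiple `n = 1`.

Honest strength.  In the tree X₂ is INCOMPARABLE with the summit (X₂ → summit only together with X₁;
summit → X₂ nowhere: it would be conservativity of the move calculus over Ayoub's Stokes span), and X₁ is a
consequence of Conjecture 1 only through the value-level cube presentation, itself not in the tree; the
cheap probes `Xᵢ → KontsevichZagierPeriods`, `Xᵢ → RationalKernel` and their converses all fail
(crux workfiles `Cruxes/RationalKernel/SPLIT-PROBES.md`).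
-- adapted from Theorems/HermiteRigidityReductionRigidityOfCubes.lean (`kernelForm_of_cubes`, the same split of HermiteRigidity's target ReductionRigidity)

References: M. Kontsevich, D. Zagier, *Periods* (2001), §1.2 Conjecture 1, §4.1; J. Ayoub, *Une version
relative de la conjecture des périodes de Kontsevich–Zagier*, Ann. of Math. 181 (2015), Conj. 1.1,
Rem. 1.2; J. Ayoub, *Periods and the conjectures of Grothendieck and Kontsevich–Zagier*, EMS Newsl. 91
(2014), Def. 9–10, Prop. 11, Rem. 12–13; J. Fresán, *Une introduction aux périodes* (2024), Conj. 3.5;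
A. Huber, S. Müller-Stach, *Periods and Nori Motives* (2017), Thm. 12.2.1, §13.1.
-/

noncomputable section

namespace Summit.KontsevichZagierPeriods.CoactionDevissage.RationalKernelSplit

open Literature.NumberTheory.Transcendental
open Summit.KontsevichZagierPeriods.FurushoPentagon.SectorToKernel
  (kzKernel_of_cubeResolution_of_ayoubKernel)

/-- **The kernel form of Conjecture 1 from the two pieces** `CubeResolution` (X₁) and
`AyoubEffectiveCubeKernel` (X₂), both written out: every formal `ℤ`-combination of integral
representations of value `0` lies in `KZ.relations`.  The import-free cube `{x | ∀ i, 0 ≤ x i ∧ x i ≤ 1}`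
is `ReducedPeriodRing.unitCube n` and the generated subgroup is `ReducedPeriodRing.cubicalSpan`,
definitionally, so X₁ is repackaged as the resolution hypothesis of the landed seven-step composition
`kzKernel_of_cubeResolution_of_ayoubKernel` (resolve → merge → admissible → soundness → real Stokes form →
semialgebraic primitives → padding + calibration).
[Ayoub 2015, Conj. 1.1; Ayoub 2014, Prop. 11, Rem. 12–13; Kontsevich–Zagier 2001, §1.2] -/
theorem kernelForm_of_subs
    (h1 : ∀ (N : ℕ) (u : Literature.NumberTheory.Transcendental.KZ.IntegralRep N), ∃ c ∈ AddSubgroup.closure {d : Literature.NumberTheory.Transcendental.KZ.FormalRep | ∃ (n : ℕ) (r : Literature.NumberTheory.Transcendental.KZ.IntegralRep n), r.domain = {x : Fin n → ℝ | ∀ i, 0 ≤ x i ∧ x i ≤ 1} ∧ AnalyticOnNhd ℝ r.integrand {x : Fin n → ℝ | ∀ i, 0 ≤ x i ∧ x i ≤ 1} ∧ d = Literature.NumberTheory.Transcendental.KZ.of r}, Literature.NumberTheory.Transcendental.KZ.of u - c ∈ Literature.NumberTheory.Transcendental.KZ.relations)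
    (h6 : ∀ F ∈ Literature.NumberTheory.Transcendental.AyoubRel.Oan (Rat.castHom ℂ), Literature.NumberTheory.Transcendental.AyoubRel.intC F = 0 → F ∈ Literature.NumberTheory.Transcendental.AyoubRel.kSpan (Rat.castHom ℂ) {x : Literature.NumberTheory.Transcendental.AyoubRel.CSeries | ∃ G ∈ Literature.NumberTheory.Transcendental.AyoubRel.Oan (Rat.castHom ℂ), ∃ i : ℕ, x = Literature.NumberTheory.Transcendental.AyoubRel.relAC i G}) :
    ∀ c : KZ.FormalRep, KZ.eval c = 0 → c ∈ KZ.relations := by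
  refine kzKernel_of_cubeResolution_of_ayoubKernel (fun N u => ?_) h6
  obtain ⟨c, hc, huc⟩ := h1 N u
  exact ⟨c, hc, huc⟩

/-- **The split of the deciding crux**: `CubeResolution → AyoubEffectiveCubeKernel → RationalKernel`
(the two pieces written out; the conclusion is the route decl `CoactionDevissage.RationalKernel` BY NAME).
The pieces give the kernel form of Conjecture 1 (`kernelForm_of_subs`, the seven-step seam), and the
kernel form gives `RationalKernel` with the multiple `n = 1`.  This is the glue theorem of the
crux-strategist redirect `RationalKernel ⟸ CubeResolution ∧ AyoubEffectiveCubeKernel`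
(items stmt-KontsevichZagierPeriods-17978, -18116).
[Kontsevich–Zagier 2001, §1.2 Conjecture 1] [Ayoub 2015, Conj. 1.1] [Huber–Müller-Stach 2017, §13.1] -/
theorem RationalKernel_of_subs :
    (∀ (N : ℕ) (u : Literature.NumberTheory.Transcendental.KZ.IntegralRep N), ∃ c ∈ AddSubgroup.closure {d : Literature.NumberTheory.Transcendental.KZ.FormalRep | ∃ (n : ℕ) (r : Literature.NumberTheory.Transcendental.KZ.IntegralRep n), r.domain = {x : Fin n → ℝ | ∀ i, 0 ≤ x i ∧ x i ≤ 1} ∧ AnalyticOnNhd ℝ r.integrand {x : Fin n → ℝ | ∀ i, 0 ≤ x i ∧ x i ≤ 1} ∧ d = Literature.NumberTheory.Transcendental.KZ.of r}, Literature.NumberTheory.Transcendental.KZ.of u - c ∈ Literature.NumberTheory.Transcendental.KZ.relations) →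
    (∀ F ∈ Literature.NumberTheory.Transcendental.AyoubRel.Oan (Rat.castHom ℂ), Literature.NumberTheory.Transcendental.AyoubRel.intC F = 0 → F ∈ Literature.NumberTheory.Transcendental.AyoubRel.kSpan (Rat.castHom ℂ) {x : Literature.NumberTheory.Transcendental.AyoubRel.CSeries | ∃ G ∈ Literature.NumberTheory.Transcendental.AyoubRel.Oan (Rat.castHom ℂ), ∃ i : ℕ, x = Literature.NumberTheory.Transcendental.AyoubRel.relAC i G}) →
    Summit.KontsevichZagierPeriods.KontsevichZagierPeriods.Theses.CoactionDevissage.RationalKernel := by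
  intro h1 h6 c hc
  exact ⟨1, one_ne_zero, by simpa using kernelForm_of_subs h1 h6 c hc⟩

/-- **Torsion-freeness of `P_KZ` from the two pieces** (the other hypothesis of the route's deciding
theorem, here a by-product): if `n • c ∈ KZ.relations` with `n ≠ 0` then `KZ.eval c = 0` by soundness
(`KZ.relations_le_ker_eval_holds`), so `c ∈ KZ.relations` by the kernel form `kernelForm_of_subs`.
[Kontsevich–Zagier 2001, §1.2] [folklore] -/
theorem torsionFree_of_subs
    (h1 : ∀ (N : ℕ) (u : Literature.NumberTheory.Transcendental.KZ.IntegralRep N), ∃ c ∈ AddSubgroup.closure {d : Literature.NumberTheory.Transcendental.KZ.FormalRep | ∃ (n : ℕ) (r : Literature.NumberTheory.Transcendental.KZ.IntegralRep n), r.domain = {x : Fin n → ℝ | ∀ i, 0 ≤ x i ∧ x i ≤ 1} ∧ AnalyticOnNhd ℝ r.integrand {x : Fin n → ℝ | ∀ i, 0 ≤ x i ∧ x i ≤ 1} ∧ d = Literature.NumberTheory.Transcendental.KZ.of r}, Literature.NumberTheory.Transcendental.KZ.of u - c ∈ Literature.NumberTheory.Transcendental.KZ.relations)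
    (h6 : ∀ F ∈ Literature.NumberTheory.Transcendental.AyoubRel.Oan (Rat.castHom ℂ), Literature.NumberTheory.Transcendental.AyoubRel.intC F = 0 → F ∈ Literature.NumberTheory.Transcendental.AyoubRel.kSpan (Rat.castHom ℂ) {x : Literature.NumberTheory.Transcendental.AyoubRel.CSeries | ∃ G ∈ Literature.NumberTheory.Transcendental.AyoubRel.Oan (Rat.castHom ℂ), ∃ i : ℕ, x = Literature.NumberTheory.Transcendental.AyoubRel.relAC i G}) :
    Summit.KontsevichZagierPeriods.KontsevichZagierPeriods.Theses.CoactionDevissage.TorsionFree := by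
  intro n c hn hnc
  refine kernelForm_of_subs h1 h6 c ?_
  have h : KZ.eval (n • c) = 0 := KZ.relations_le_ker_eval_holds hnc
  rw [map_nsmul, nsmul_eq_mul, mul_eq_zero] at h
  exact h.resolve_left (Nat.cast_ne_zero.mpr hn)

/-- **The split feeds the route's deciding theorem**: with the two pieces, BOTH hypotheses of
`CoactionDevissage.closes` (`TorsionFree`, `RationalKernel`) are discharged, hence the summit
`KontsevichZagierPeriods` — one direction of Ayoub's remark that Conj. 1.1 is "une reformulation de la
conjecture des périodes", made kernel-checkable for the calculus of `KZCalculus.lean`.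
[Ayoub 2015, §1.1] [Kontsevich–Zagier 2001, §1.2 Conjecture 1] -/
theorem kontsevichZagierPeriods_of_subs
    (h1 : ∀ (N : ℕ) (u : Literature.NumberTheory.Transcendental.KZ.IntegralRep N), ∃ c ∈ AddSubgroup.closure {d : Literature.NumberTheory.Transcendental.KZ.FormalRep | ∃ (n : ℕ) (r : Literature.NumberTheory.Transcendental.KZ.IntegralRep n), r.domain = {x : Fin n → ℝ | ∀ i, 0 ≤ x i ∧ x i ≤ 1} ∧ AnalyticOnNhd ℝ r.integrand {x : Fin n → ℝ | ∀ i, 0 ≤ x i ∧ x i ≤ 1} ∧ d = Literature.NumberTheory.Transcendental.KZ.of r}, Literature.NumberTheory.Transcendental.KZ.of u - c ∈ Literature.NumberTheory.Transcendental.KZ.relations)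
    (h6 : ∀ F ∈ Literature.NumberTheory.Transcendental.AyoubRel.Oan (Rat.castHom ℂ), Literature.NumberTheory.Transcendental.AyoubRel.intC F = 0 → F ∈ Literature.NumberTheory.Transcendental.AyoubRel.kSpan (Rat.castHom ℂ) {x : Literature.NumberTheory.Transcendental.AyoubRel.CSeries | ∃ G ∈ Literature.NumberTheory.Transcendental.AyoubRel.Oan (Rat.castHom ℂ), ∃ i : ℕ, x = Literature.NumberTheory.Transcendental.AyoubRel.relAC i G}) :
    KontsevichZagierPeriods :=
  Summit.KontsevichZagierPeriods.KontsevichZagierPeriods.Theses.CoactionDevissage.closes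
    (torsionFree_of_subs h1 h6) (RationalKernel_of_subs h1 h6)

/-- **`RationalKernelOfCubes`** (item stmt-KontsevichZagierPeriods-17690 of route CoactionDevissage, the SPLIT GLUE as a
route decl): `CubeResolution → AyoubEffectiveCubeKernel → RationalKernel`, all three BY NAME (route file rev ≥ 6).  The two
children unfold to the written-out hypotheses of `RationalKernel_of_subs`.
[Kontsevich–Zagier 2001, §1.2 Conjecture 1] [Ayoub 2015, Conj. 1.1] -/
theorem rationalKernelOfCubes_proof :
    Summit.KontsevichZagierPeriods.KontsevichZagierPeriods.Theses.CoactionDevissage.RationalKernelOfCubes := by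
  unfold Summit.KontsevichZagierPeriods.KontsevichZagierPeriods.Theses.CoactionDevissage.RationalKernelOfCubes
  intro h1 h6
  unfold Summit.KontsevichZagierPeriods.KontsevichZagierPeriods.Theses.CoactionDevissage.CubeResolution at h1
  unfold Summit.KontsevichZagierPeriods.KontsevichZagierPeriods.Theses.CoactionDevissage.AyoubEffectiveCubeKernel at h6
  exact RationalKernel_of_subs h1 h6

end Summit.KontsevichZagierPeriods.CoactionDevissage.RationalKernelSplit
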